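import Summits.ABC.ABC.Theses.IsogenyGlueCongruence
import Literature.NumberTheory.EllipticCurves.HeckeCongruenceModulus

/-!
# Sketch — crux-ideate stmt-ABC-16006 (`PolyHeightOfBoundedPrimes`, B' = A → H), ideator k=1, round 1

First lemmas of the two idea cards (must elaborate; proofs where cheap).

* Card `first-prime-separation`: `charge_at_prime` — Pasten's congruence modulus `η_f(P)` divides
  `Q(a_p(f))` for every integer polynomial `Q` with `Q(T_p) ∈ P` (take `Q` = minimal polynomial of
  `a_p(g)` for the class `P = 𝕀_{[g]}`): the archimedean charge of a Hecke class at ONE good prime.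
  Plus the typed shapes `EffectiveVerticalSatoTatePointMass` (Murty–Sinha 2009, named-fact shape),
  `LogLogDegreeBound` (the provable-in-print deliverable) and `TotalContactBound` (the crux-level C⁺).
* Card `archimedean-hall-split`: `H_of_split` — (discriminant-form polynomial Szpiro) ∧
  (polynomial Hall on the discriminant Mordell curves) → H (consequent of B'), hence → B'.
-/

noncomputable section

open scoped MatrixGroups ModularForm
open CongruenceSubgroup
open Literature.NumberTheory.EllipticCurves.ModularForms
open Summit.ABC.ABC.Theses.IsogenyGlueCongruence

namespace Summit.ABC.ABC.Cruxes.PolyHeightOfBoundedPrimes.Ideator1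

/-! ## Card 1: first-prime separation -/

/-- FIRST LEMMA (card `first-prime-separation`): the charge of a Hecke class at one good prime.
If `Q ∈ ℤ[x]` kills `T_p` modulo the ideal `P` of the anemic Hecke ring (e.g. `Q` = the minimal
polynomial of `a_p(g)` and `P = 𝕀_{[g]} = ker χ_g`), then `η_f(P) ∣ Q(a_p(f))`; with
`|Q(a_p(f))| ≤ (4√p)^{deg Q}` (Hasse–Deligne) this charges the class `[g]` only
`[ℚ(a_p(g)):ℚ]·log(4√p)` as soon as `a_p(g) ≠ a_p(f)`. -/
theorem charge_at_prime {N : ℕ} [NeZero N] {k : ℤ} {f : CuspForm (Gamma0 N) k}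
    (hf : HasIntegralEigenvalues f) (hf0 : f ≠ 0) (P : Ideal (anemicHeckeRing N k))
    (p : ℕ) [NeZero p] (hp : p.Prime) (hpN : ¬ p ∣ N) (Q : Polynomial ℤ)
    (hQ : Polynomial.aeval (anemicHeckeRing.T N k p hp hpN) Q ∈ P) :
    (heckeCongruenceModulus f P : ℤ) ∣
      Q.eval (intEigencharacter hf hf0 (anemicHeckeRing.T N k p hp hpN)) := by
  have h := heckeCongruenceModulus_dvd_of_mem hf hf0 hQ
  have key : intEigencharacter hf hf0 (Polynomial.aeval (anemicHeckeRing.T N k p hp hpN) Q) =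
      Q.eval (intEigencharacter hf hf0 (anemicHeckeRing.T N k p hp hpN)) := by
    rw [Polynomial.aeval_def, Polynomial.hom_eval₂,
      show (intEigencharacter hf hf0).comp (algebraMap ℤ (anemicHeckeRing N k)) = RingHom.id ℤ from
        RingHom.ext_int _ _]
    rfl
  simpa [key] using h

/-- Named-fact SHAPE of the analytic input (Murty–Sinha 2009, effective vertical Sato–Tate, point
mass form): the multiplicity of any eigenvalue of `T_p` (`p ∤ N`) on `S₂(Γ₀(N))` is
`≤ C · dim S₂(Γ₀(N)) · log p / log N`. To be vendored as a Literature fact by a grounder. -/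
def EffectiveVerticalSatoTatePointMass : Prop :=
  ∃ C : ℝ, ∀ (N : ℕ) [NeZero N] (p : ℕ) [NeZero p], p.Prime → ¬ p ∣ N → 3 ≤ N → ∀ a : ℂ,
    (Module.finrank ℂ (LinearMap.ker (heckeT (Gamma0 N) 2 p - a • 1)) : ℝ) ≤
      C * Module.finrank ℂ (CuspForm (Gamma0 N) 2) * Real.log p / Real.log N

/-- The card's PROVABLE-IN-PRINT deliverable (new unconditional bound, GRH removed from Pasten
2024 Thm 7.4 at the cost of one `log log`): `log deg φ ≤ C·N·(log log N)²` for every modular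
parametrisation datum of minimal degree of a semistable curve (`ψ(N) ≤ c N log log N`). -/
def LogLogDegreeBound : Prop :=
  ∃ C : ℝ, ∀ (W : WeierstrassCurve ℚ) [W.IsElliptic] [W.IsGloballyMinimal]
    [NeZero (W.conductorNorm ℤ)], W.IsSemistable ℤ → 16 ≤ W.conductorNorm ℤ →
    (∃ D₀ : ModularParametrizationData W (W.conductorNorm ℤ), True) →
    ∃ D : ModularParametrizationData W (W.conductorNorm ℤ),
      Real.log D.modularDegree ≤
        C * (W.conductorNorm ℤ : ℝ) * (Real.log (Real.log (W.conductorNorm ℤ))) ^ 2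

/-- The crux-level transfer `C⁺` (sufficient for H, hence for B'): the TOTAL CONTACT of the
newform of `W` with the other Hecke classes — the sum of `log η_f(P)` over the minimal primes
`P ≠ 𝕀_f` of the anemic Hecke ring — is `O(log N)`. By Pasten Thm 5.5
(`congruenceNumber_dvd_prod_heckeCongruenceModulus`) and Ribet it bounds `log deg φ`. -/
def TotalContactBound : Prop :=
  ∃ κ C : ℝ, ∀ (W : WeierstrassCurve ℚ) [W.IsElliptic] [W.IsGloballyMinimal]
    [NeZero (W.conductorNorm ℤ)], W.IsSemistable ℤ →
    ∀ f : CuspForm (Gamma0 (W.conductorNorm ℤ)) 2, IsNewformOf W f →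
    ∀ s : Finset (Ideal (anemicHeckeRing (W.conductorNorm ℤ) 2)),
      (↑s : Set _) ⊆ minimalPrimes (anemicHeckeRing (W.conductorNorm ℤ) 2) → eigenIdeal f ∉ s →
      ∑ P ∈ s, Real.log (heckeCongruenceModulus f P) ≤
        κ * Real.log (W.conductorNorm ℤ : ℝ) + C

/-! ## Card 2: archimedean Hall split -/

/-- Discriminant form of polynomial Szpiro for semistable curves (finite places only). -/
def PolySzpiroΔ : Prop :=
  ∃ σ C : ℝ, ∀ (W : WeierstrassCurve ℚ) [W.IsElliptic] [W.IsGloballyMinimal]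
    [NeZero (W.conductorNorm ℤ)], W.IsSemistable ℤ →
    ((|W.Δ| : ℚ) : ℝ) ≤ C * (W.conductorNorm ℤ : ℝ) ^ σ

/-- Polynomial Hall on the discriminant Mordell curves `c₆² = c₄³ − 1728Δ` of semistable global
minimal models: the archimedean exponent `log⁺|j| = log|c₄|³ − log|Δ|` is polynomially bounded by
the finite ones. Automatic on Frey curves (`|c₄|³ ≤ 13824·Δ^{3/2}` on the Frey model); implied
by Hall's conjecture, by abc, by X. -/
def PolyHallΔ : Prop :=
  ∃ σ C : ℝ, 0 ≤ σ ∧ ∀ (W : WeierstrassCurve ℚ) [W.IsElliptic] [W.IsGloballyMinimal]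
    [NeZero (W.conductorNorm ℤ)], W.IsSemistable ℤ →
    ((|W.c₄| ^ 3 : ℚ) : ℝ) ≤ C * ((|W.Δ| : ℚ) : ℝ) ^ σ

/-- The consequent H of crux B' (verbatim). -/
def PolyHeight : Prop :=
  ∃ σ C : ℝ, ∀ (W : WeierstrassCurve ℚ) [W.IsElliptic] [W.IsGloballyMinimal]
    [NeZero (W.conductorNorm ℤ)], W.IsSemistable ℤ →
    ((max |W.Δ| (|W.c₄| ^ 3) : ℚ) : ℝ) ≤ C * (W.conductorNorm ℤ : ℝ) ^ σ

/-- FIRST LEMMA (card `archimedean-hall-split`): the two halves give H. -/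
theorem polyHeight_of_split (hΔ : PolySzpiroΔ) (hHall : PolyHallΔ) : PolyHeight := by
  obtain ⟨σ₁, C₁, h₁⟩ := hΔ
  obtain ⟨σ₂, C₂, hσ₂, h₂⟩ := hHall
  refine ⟨max σ₁ 0 + max σ₁ 0 * σ₂, max C₁ 1 + max C₂ 0 * (max C₁ 1) ^ σ₂, ?_⟩
  intro W _ _ _ hW
  set C₁' : ℝ := max C₁ 1 with hC₁'
  set σ₁' : ℝ := max σ₁ 0 with hσ₁'
  set C₂' : ℝ := max C₂ 0 with hC₂'
  set N : ℝ := (W.conductorNorm ℤ : ℝ) with hNdef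
  have hN : (1 : ℝ) ≤ N := by
    rw [hNdef]; exact_mod_cast Nat.one_le_iff_ne_zero.mpr (NeZero.ne _)
  have hN0 : (0 : ℝ) ≤ N := by linarith
  have hC₁'1 : (1 : ℝ) ≤ C₁' := le_max_right _ _
  have hC₁'0 : (0 : ℝ) ≤ C₁' := by linarith
  have hσ₁'0 : (0 : ℝ) ≤ σ₁' := le_max_right _ _
  have hC₂'0 : (0 : ℝ) ≤ C₂' := le_max_right _ _
  have hΔ0 : (0 : ℝ) ≤ ((|W.Δ| : ℚ) : ℝ) := by exact_mod_cast abs_nonneg _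
  -- finite half
  have eΔ : ((|W.Δ| : ℚ) : ℝ) ≤ C₁' * N ^ σ₁' :=
    calc ((|W.Δ| : ℚ) : ℝ) ≤ C₁ * N ^ σ₁ := h₁ W hW
      _ ≤ C₁' * N ^ σ₁ := mul_le_mul_of_nonneg_right (le_max_left _ _) (Real.rpow_nonneg hN0 _)
      _ ≤ C₁' * N ^ σ₁' :=
        mul_le_mul_of_nonneg_left (Real.rpow_le_rpow_of_exponent_le hN (le_max_left _ _)) hC₁'0
  -- archimedean half
  have ec : ((|W.c₄| ^ 3 : ℚ) : ℝ) ≤ C₂' * C₁' ^ σ₂ * N ^ (σ₁' * σ₂) :=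
    calc ((|W.c₄| ^ 3 : ℚ) : ℝ) ≤ C₂ * ((|W.Δ| : ℚ) : ℝ) ^ σ₂ := h₂ W hW
      _ ≤ C₂' * ((|W.Δ| : ℚ) : ℝ) ^ σ₂ :=
        mul_le_mul_of_nonneg_right (le_max_left _ _) (Real.rpow_nonneg hΔ0 _)
      _ ≤ C₂' * (C₁' * N ^ σ₁') ^ σ₂ :=
        mul_le_mul_of_nonneg_left (Real.rpow_le_rpow hΔ0 eΔ hσ₂) hC₂'0
      _ = C₂' * C₁' ^ σ₂ * N ^ (σ₁' * σ₂) := by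
        rw [Real.mul_rpow hC₁'0 (Real.rpow_nonneg hN0 _), ← Real.rpow_mul hN0]; ring
  have hpow1 : N ^ σ₁' ≤ N ^ (σ₁' + σ₁' * σ₂) :=
    Real.rpow_le_rpow_of_exponent_le hN (by nlinarith)
  have hpow2 : N ^ (σ₁' * σ₂) ≤ N ^ (σ₁' + σ₁' * σ₂) :=
    Real.rpow_le_rpow_of_exponent_le hN (by nlinarith)
  have hK : (0 : ℝ) ≤ C₂' * C₁' ^ σ₂ := mul_nonneg hC₂'0 (Real.rpow_nonneg hC₁'0 _)
  have hpow0 : (0 : ℝ) ≤ N ^ (σ₁' + σ₁' * σ₂) := Real.rpow_nonneg hN0 _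
  rw [Rat.cast_max]
  apply max_le
  · calc ((|W.Δ| : ℚ) : ℝ) ≤ C₁' * N ^ σ₁' := eΔ
      _ ≤ C₁' * N ^ (σ₁' + σ₁' * σ₂) := mul_le_mul_of_nonneg_left hpow1 hC₁'0
      _ ≤ (C₁' + C₂' * C₁' ^ σ₂) * N ^ (σ₁' + σ₁' * σ₂) :=
        mul_le_mul_of_nonneg_right (by linarith) hpow0
  · calc ((|W.c₄| ^ 3 : ℚ) : ℝ) ≤ C₂' * C₁' ^ σ₂ * N ^ (σ₁' * σ₂) := ec
      _ ≤ C₂' * C₁' ^ σ₂ * N ^ (σ₁' + σ₁' * σ₂) := mul_le_mul_of_nonneg_left hpow2 hK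
      _ ≤ (C₁' + C₂' * C₁' ^ σ₂) * N ^ (σ₁' + σ₁' * σ₂) :=
        mul_le_mul_of_nonneg_right (by linarith) hpow0

/-- … hence B' (A idle): -/
theorem polyHeightOfBoundedPrimes_of_split (hΔ : PolySzpiroΔ) (hHall : PolyHallΔ) :
    PolyHeightOfBoundedPrimes := fun _ ↦ polyHeight_of_split hΔ hHall

/-- Converse bookkeeping (H → both halves) needs only `N ∣ Δ` (`1 ≤ N ≤ |Δ|`) for semistable
minimal models; recorded as a statement. -/
def SplitIffShape : Prop := PolyHeight ↔ (PolySzpiroΔ ∧ PolyHallΔ)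

end Summit.ABC.ABC.Cruxes.PolyHeightOfBoundedPrimes.Ideator1
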